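import Summits.QuantumFields.YangMills.Theorems.BalabanUVNodesN08HaarCompatibilityPrivateSources

/-!
# BalabanUVNodes ∕ N08 — E6′ AT THE RECORD'S AVERAGING HOLDS ON EVERY FOREST: under ANY gauge-invariant law (so under the image law `Ū_*(dU)` of every covariant
# averaging, [Balaban1987RG1] p. 265), the bond variables along ANY ACYCLIC family of bonds are EXACTLY product-Haar distributed; at `Ū := avOfPrint N S j` and for
# EVERY version `𝔗` of (10), `∫ T1 · φ(V ∘ b) dV = ∫ φ(V ∘ b) dV` on forests — so the E6′ defect lives ENTIRELY in the joint law of CYCLE holonomies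

WIDTH SEAT `pub-ymgap-dag-n08-w3` g0, plan `W-SEAT-START-LIST.md` §n08 item 3 PART 4, 2026-08-28.  Track A, DAG node N08 = [Balaban1985UV3] Thm 1 p. 257 (compact) + Thm 2
p. 272; key item K1⁷ `StabilityBAtRecordR13SepCoPH` (stmt-QuantumFields-20542), `--supports … --as helper`.  COUNT-NEUTRAL.  Parts 1–3: `…N08HaarCompatibilityInhabited`
(p583667), `…OneBond` (p585871), `…PrivateSources` (p588078).  This part removes part 3's «private endpoint» restriction: the statement cell ym3-torus's
`AveragingImageLawGaugeInvariance` header records as «recorded, not formalised» — E6′ can fail ONLY through cycle holonomies — is formalised for every forest.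

A FOREST is presented by a LEAF-EXTENSION ORDER (every finite forest has one; conversely such a family is a forest): bonds `b : Fin n → PBond P k` and a side selector
`side : Fin n → Bool` such that the selected endpoint of `b m` (`src` if `side m`, else `tgt`) is an endpoint of NO EARLIER bond `b m'`, `m' < m` (hypothesis `hleaf`,
spelled inline; no definition introduced; inhabited: `leafOrder_single`, `leafOrder_pair`).  NO topology on `G` is needed: the gauge transformation at the selected
endpoint of the LAST bond right-translates that (signed) bond variable and fixes all earlier ones (`exists_gaugeTransf_last`), so the last variable's law conditioned on
a box in the earlier ones is translation invariant, hence `mass • Haar` by the tree's Weil-type uniqueness `AveragingRT.measure_eq_mass_smul_of_invariant`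
(`eq_mass_smul_haar_of_map_mul_right`); induction on `n` with `Measure.pi_eq` gives **`map_signedEvalFamily_eq_pi_haar`** and, un-signing (`map_signFix_pi_haar`),
**`map_evalFamily_eq_pi_haar_of_leafOrder`**: for EVERY gauge-invariant probability law `ν`, `ν ∘ (V ↦ V ∘ b)⁻¹ = Haar^n` on every forest; `integral_comp_evalFamily_of_leafOrder`.
§2: at `dU` (`map_evalFamily_fieldMeasure_eq_pi_haar_of_leafOrder`) and at the image law of ANY covariant averaging of the standing range
(**`map_evalFamily_imageLaw_eq_pi_haar_of_leafOrder`**, `integral_comp_avg_evalFamily_eq_of_leafOrder`: image law and `dV` AGREE on every forest).  §3: at the [B10] slot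
(`avOfPrint N S j` on `SU(N)`, EVERY level, every `N`): `map_evalFamily_avOfPrint_eq_pi_haar_of_leafOrder`, and THE LETTER for EVERY version `𝔗 : Node00.TFamily₃ N L`:
**`integral_T_one_mul_comp_evalFamily_eq_of_leafOrder`** (`∫ (𝔗 S j).T 1 · φ(V ∘ b) dV = ∫ φ(V ∘ b) dV`), `integral_T_one_sub_one_mul_comp_evalFamily_of_leafOrder` (defect ⟂).
NOT PROVED (said): E6′ proper = the same on families WITH cycles (plaquettes; the 2-cycles of the side-2 torus, part 1 §4) — NOT IN PRINT, undecided at `N ≥ 2`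
(pub-balaban3d DEPMAP v6 §16 N22; dag-n08-a SEAM note; chair R451).  Nothing of Bałaban's asserted.

HONEST FRAMING.  Count-neutral helper; N08 NOT discharged; counts unmoved; one finite 𝕋⁴ programme at fixed ε; R4 closes the CONDITIONAL rung `BalabanLadder.UV`
only; the Yang–Mills mass gap (Clay) is NOT proved by any of this; nothing continuum ∕ ℝ³ ∕ ℝ⁴ ∕ OS ∕ mass gap.  0 `sorry`, 0 `def`, 0 `instance`, standard axioms.
-/

noncomputable section

open MeasureTheory

namespace Summit.QuantumFields.YangMills.BalabanUVNodes.N08HaarCompatibilityForests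

open Literature.MathematicalPhysics.QuantumFieldTheory.Balaban1983to89
open Literature.MathematicalPhysics.QuantumFieldTheory.Balaban1983to89.AveragingRT (measure_eq_mass_smul_of_invariant)
open Literature.MathematicalPhysics.QuantumFieldTheory.Balaban1983to89.AveragingImageLawGaugeInvariance (map_gaugeAct_imageLaw isProbabilityMeasure_imageLaw)
open Literature.MathematicalPhysics.QuantumFieldTheory.Balaban1983to89.B12RTGaugeInvariance254 (measurable_gaugeAct measurePreserving_gaugeAct)
open Literature.MathematicalPhysics.QuantumFieldTheory.Balaban1983to89.B12SmallFieldDomain259 (src_ne_tgt)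
open Summit.QuantumFields.YangMills.BalabanUVNodes.N08HaarCompatibilityPrivateSources (measurable_evalFamily map_gaugeAct_fieldMeasure)

/-! ## §1 Forests (leaf-extension orders) under a gauge-invariant law -/

section Generic

variable {P : Params} {k : ℕ} {G : Type*} [GaugeGroup G] [MeasurableSpace G] [HaarData G] [MeasurableMul₂ G] [MeasurableInv G]

/-- `if p then f x else g x` is measurable for a constant condition `p` (plumbing). [folklore] -/
private theorem measurable_ite_const {α β : Type*} [MeasurableSpace α] [MeasurableSpace β] (p : Prop) [Decidable p] {f g : α → β}
    (hf : Measurable f) (hg : Measurable g) : Measurable fun x => if p then f x else g x := by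
  by_cases h : p <;> simp [h, hf, hg]

omit [MeasurableInv G] in
/-- A finite RIGHT-invariant measure on the gauge group is its mass times the Haar datum (Weil uniqueness, any measurable group). [folklore] -/
theorem eq_mass_smul_haar_of_map_mul_right (κ : Measure G) [IsFiniteMeasure κ] (hκ : ∀ g : G, κ.map (fun x => x * g) = κ) :
    κ = κ Set.univ • (HaarData.haar : Measure G) :=
  measure_eq_mass_smul_of_invariant _ κ (fun g => HaarData.map_mul_left g) hκ

omit [MeasurableSpace G] [HaarData G] [MeasurableMul₂ G] [MeasurableInv G] in
/-- **The gauge transformation at the private endpoint of the LAST bond** of a leaf-extension-ordered family, in signed coordinates (`V(b m)⁻¹` where `side m`, i.e. where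
the private endpoint is the source; `V(b m)` where it is the target): it right-translates the last coordinate by `g⁻¹` and fixes every earlier one.
[cite: Balaban1985Averaging, (8) p.19 (bookkeeping)] -/
theorem exists_gaugeTransf_last {n : ℕ} (b : Fin (n + 1) → PBond P k) (side : Fin (n + 1) → Bool)
    (hleaf : ∀ m m' : Fin (n + 1), m' < m →
      (if side m then (b m).src else (b m).tgt) ≠ (b m').src ∧ (if side m then (b m).src else (b m).tgt) ≠ (b m').tgt)
    (g : G) :
    ∃ v : GaugeTransf P k G, ∀ V : GaugeField P k G,
      (fun m : Fin (n + 1) => if side m then (GaugeField.gaugeAct v V (b m))⁻¹ else GaugeField.gaugeAct v V (b m)) =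
        fun m => if m = Fin.last n then (if side m then (V (b m))⁻¹ else V (b m)) * g⁻¹
          else (if side m then (V (b m))⁻¹ else V (b m)) := by
  classical
  set x : Site P k := if side (Fin.last n) then (b (Fin.last n)).src else (b (Fin.last n)).tgt with hx
  refine ⟨fun y => if y = x then g else 1, fun V => ?_⟩
  funext m
  by_cases hm : m = Fin.last n
  · subst hm
    rw [if_pos rfl]
    cases hs : side (Fin.last n)
    · -- private endpoint = target: `1 · V · g⁻¹`
      have hxt : x = (b (Fin.last n)).tgt := by rw [hx, hs]; rfl
      have hsrc : (b (Fin.last n)).src ≠ x := by rw [hxt]; exact src_ne_tgt _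
      simp only [GaugeField.gaugeAct, Bool.false_eq_true, if_false]
      rw [if_neg hsrc, if_pos hxt.symm, one_mul]
    · -- private endpoint = source: `(g · V · 1)⁻¹ = V⁻¹ g⁻¹`
      have hxs : x = (b (Fin.last n)).src := by rw [hx, hs]; rfl
      have htgt : (b (Fin.last n)).tgt ≠ x := by rw [hxs]; exact fun h => src_ne_tgt _ h.symm
      simp only [GaugeField.gaugeAct, if_true]
      rw [if_pos hxs.symm, if_neg htgt, inv_one, mul_one, mul_inv_rev]
  · -- an earlier bond: both endpoints differ from `x`
    rw [if_neg hm]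
    have hlt : m < Fin.last n := lt_of_le_of_ne (Fin.le_last m) hm
    have h1 : (b m).src ≠ x := fun h => (hleaf (Fin.last n) m hlt).1 (by rw [hx] at h; exact h.symm)
    have h2 : (b m).tgt ≠ x := fun h => (hleaf (Fin.last n) m hlt).2 (by rw [hx] at h; exact h.symm)
    simp only [GaugeField.gaugeAct]
    rw [if_neg h1, if_neg h2, one_mul, inv_one, mul_one]

omit [HaarData G] [MeasurableMul₂ G] in
/-- The signed family-evaluation map is measurable. [folklore] -/
theorem measurable_signedEvalFamily {n : ℕ} (b : Fin n → PBond P k) (side : Fin n → Bool) :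
    Measurable fun (V : GaugeField P k G) (m : Fin n) => if side m then (V (b m))⁻¹ else V (b m) := by
  refine measurable_pi_lambda _ fun m => ?_
  have hev : Measurable fun V : GaugeField P k G => V (b m) := measurable_pi_apply (b m)
  exact measurable_ite_const (side m = true) (f := fun V : GaugeField P k G => (V (b m))⁻¹) (g := fun V => V (b m)) hev.inv hev

/-- Two probability measures on a one-point space agree (base case). [folklore] -/
private theorem measure_eq_of_subsingleton {α : Type*} [MeasurableSpace α] [Subsingleton α] (μ ν : Measure α)
    [IsProbabilityMeasure μ] [IsProbabilityMeasure ν] : μ = ν := by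
  ext s _
  rcases Set.eq_empty_or_nonempty s with h | h
  · rw [h, measure_empty, measure_empty]
  · rw [Subsingleton.eq_univ_of_nonempty h, measure_univ, measure_univ]

/-- **FORESTS ARE PRODUCT HAAR UNDER EVERY GAUGE-INVARIANT LAW (signed coordinates)**: for every probability measure `ν` on `GaugeField P k G` invariant under all gauge
transformations and every leaf-extension-ordered family `(b, side)`, the signed bond variables are independent Haar.  Induction on `n`: the last coordinate's law
conditioned on a box in the earlier ones is right-invariant (`exists_gaugeTransf_last`), hence `mass • Haar` (`eq_mass_smul_haar_of_map_mul_right`); the mass is the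
induction hypothesis; `Measure.pi_eq`. [cite: Balaban1987RG1, (2.1) p.265 (the gauge-invariance sentence this reads); folklore] -/
theorem map_signedEvalFamily_eq_pi_haar (n : ℕ) :
    ∀ (b : Fin n → PBond P k) (side : Fin n → Bool)
      (_hleaf : ∀ m m' : Fin n, m' < m →
        (if side m then (b m).src else (b m).tgt) ≠ (b m').src ∧ (if side m then (b m).src else (b m).tgt) ≠ (b m').tgt)
      (ν : Measure (GaugeField P k G)) [IsProbabilityMeasure ν] (_hν : ∀ v : GaugeTransf P k G, ν.map (GaugeField.gaugeAct v) = ν),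
      ν.map (fun (V : GaugeField P k G) (m : Fin n) => if side m then (V (b m))⁻¹ else V (b m)) =
        Measure.pi fun _ : Fin n => (HaarData.haar : Measure G) := by
  induction n with
  | zero =>
    intro b side _ ν _ _
    haveI : IsProbabilityMeasure (ν.map fun (V : GaugeField P k G) (m : Fin 0) => if side m then (V (b m))⁻¹ else V (b m)) :=
      Measure.isProbabilityMeasure_map (measurable_signedEvalFamily b side).aemeasurable
    exact measure_eq_of_subsingleton _ _
  | succ n ih =>
    intro b side hleaf ν _ hν
    set Ψ : GaugeField P k G → (Fin (n + 1) → G) := fun V m => if side m then (V (b m))⁻¹ else V (b m) with hΨ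
    have hΨm : Measurable Ψ := measurable_signedEvalFamily b side
    set ρ : Measure (Fin (n + 1) → G) := ν.map Ψ with hρ
    haveI : IsProbabilityMeasure ρ := Measure.isProbabilityMeasure_map hΨm.aemeasurable
    set Ψ' : GaugeField P k G → (Fin n → G) := fun V j => if side (Fin.castSucc j) then (V (b (Fin.castSucc j)))⁻¹ else V (b (Fin.castSucc j)) with hΨ'
    have hleaf' : ∀ m m' : Fin n, m' < m →
        (if side (Fin.castSucc m) then (b (Fin.castSucc m)).src else (b (Fin.castSucc m)).tgt) ≠ (b (Fin.castSucc m')).src ∧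
          (if side (Fin.castSucc m) then (b (Fin.castSucc m)).src else (b (Fin.castSucc m)).tgt) ≠ (b (Fin.castSucc m')).tgt :=
      fun m m' h => hleaf (Fin.castSucc m) (Fin.castSucc m') (Fin.castSucc_lt_castSucc_iff.mpr h)
    have hIH : ν.map Ψ' = Measure.pi fun _ : Fin n => (HaarData.haar : Measure G) :=
      ih (fun j => b (Fin.castSucc j)) (fun j => side (Fin.castSucc j)) hleaf' ν hν
    set r : (Fin (n + 1) → G) → (Fin n → G) := fun W j => W (Fin.castSucc j) with hr
    have hrm : Measurable r := measurable_pi_lambda _ fun j => measurable_pi_apply _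
    have hrΨ : r ∘ Ψ = Ψ' := by funext V; rfl
    have hρr : ρ.map r = Measure.pi fun _ : Fin n => (HaarData.haar : Measure G) := by
      rw [hρ, Measure.map_map hrm hΨm, hrΨ, hIH]
    have hTm : ∀ g : G, Measurable fun (W : Fin (n + 1) → G) (m : Fin (n + 1)) => if m = Fin.last n then W m * g else W m :=
      fun g => measurable_pi_lambda _ fun m =>
        measurable_ite_const (m = Fin.last n) (f := fun W : Fin (n + 1) → G => W m * g) (g := fun W => W m)
          ((measurable_pi_apply m : Measurable fun W : Fin (n + 1) → G => W m).mul_const g)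
          (measurable_pi_apply m : Measurable fun W : Fin (n + 1) → G => W m)
    have hρT : ∀ g : G, ρ.map (fun W m => if m = Fin.last n then W m * g else W m) = ρ := by
      intro g
      obtain ⟨v, hv⟩ := exists_gaugeTransf_last b side hleaf g⁻¹
      have hT := hTm g
      have hcomp : (fun (W : Fin (n + 1) → G) (m : Fin (n + 1)) => if m = Fin.last n then W m * g else W m) ∘ Ψ = Ψ ∘ GaugeField.gaugeAct v := by
        funext V
        have h := hv V
        simp only [inv_inv] at h
        simp only [Function.comp, hΨ]
        rw [h]
      rw [hρ, Measure.map_map hT hΨm, hcomp, ← Measure.map_map hΨm (measurable_gaugeAct v), hν v]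
    refine (Measure.pi_eq fun s hs => ?_).symm
    set C : Set (Fin (n + 1) → G) := {W | ∀ j : Fin n, W (Fin.castSucc j) ∈ s (Fin.castSucc j)} with hC
    have hCeq : C = r ⁻¹' (Set.univ.pi fun j : Fin n => s (Fin.castSucc j)) := by
      ext W; simp [hC, hr]
    have hCm : MeasurableSet C := by
      rw [hCeq]; exact hrm (MeasurableSet.univ_pi fun j => hs (Fin.castSucc j))
    have hρC : ρ C = ∏ j : Fin n, (HaarData.haar : Measure G) (s (Fin.castSucc j)) := by
      rw [hCeq, ← Measure.map_apply hrm (MeasurableSet.univ_pi fun j => hs (Fin.castSucc j)), hρr, Measure.pi_pi]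
    set μC : Measure G := (ρ.restrict C).map (fun W => W (Fin.last n)) with hμC
    have hlastm : Measurable fun W : Fin (n + 1) → G => W (Fin.last n) := measurable_pi_apply _
    haveI : IsFiniteMeasure μC := by rw [hμC]; infer_instance
    have hμC_apply : ∀ A : Set G, MeasurableSet A → μC A = ρ ({W | W (Fin.last n) ∈ A} ∩ C) := by
      intro A hA
      rw [hμC, Measure.map_apply hlastm hA, Measure.restrict_apply (hlastm hA)]
      rfl
    have hμC_inv : ∀ g : G, μC.map (fun x => x * g) = μC := by
      intro g
      ext A hA
      rw [Measure.map_apply (measurable_mul_const g) hA, hμC_apply _ (measurable_mul_const g hA), hμC_apply A hA]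
      have hpre : (fun (W : Fin (n + 1) → G) (m : Fin (n + 1)) => if m = Fin.last n then W m * g else W m) ⁻¹'
          ({W | W (Fin.last n) ∈ A} ∩ C) = {W | W (Fin.last n) * g ∈ A} ∩ C := by
        ext W
        simp only [Set.mem_preimage, Set.mem_inter_iff, Set.mem_setOf_eq, if_true, hC, Fin.castSucc_ne_last, if_false]
      have hT := hTm g
      have hmeasAC : MeasurableSet ({W : Fin (n + 1) → G | W (Fin.last n) ∈ A} ∩ C) := (hlastm hA).inter hCm
      calc ρ ({W | W (Fin.last n) * g ∈ A} ∩ C)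
          = ρ ((fun (W : Fin (n + 1) → G) (m : Fin (n + 1)) => if m = Fin.last n then W m * g else W m) ⁻¹'
              ({W | W (Fin.last n) ∈ A} ∩ C)) := by rw [hpre]
        _ = (ρ.map fun (W : Fin (n + 1) → G) (m : Fin (n + 1)) => if m = Fin.last n then W m * g else W m)
              ({W | W (Fin.last n) ∈ A} ∩ C) := (Measure.map_apply hT hmeasAC).symm
        _ = ρ ({W | W (Fin.last n) ∈ A} ∩ C) := by rw [hρT g]
    have hμC_eq : μC = μC Set.univ • (HaarData.haar : Measure G) := eq_mass_smul_haar_of_map_mul_right μC hμC_inv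
    have hμC_univ : μC Set.univ = ρ C := by
      rw [hμC_apply _ MeasurableSet.univ]
      congr 1
      ext W; simp
    have hbox : Set.univ.pi s = {W : Fin (n + 1) → G | W (Fin.last n) ∈ s (Fin.last n)} ∩ C := by
      ext W
      simp only [Set.mem_univ_pi, Set.mem_inter_iff, Set.mem_setOf_eq, hC]
      rw [Fin.forall_fin_succ']
      exact and_comm
    rw [hbox, ← hμC_apply _ (hs (Fin.last n)), hμC_eq, Measure.smul_apply, smul_eq_mul, hμC_univ, hρC, Fin.prod_univ_castSucc]

omit [MeasurableMul₂ G] in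
/-- Coordinatewise «un-signing» preserves the product Haar measure (`Haar` is inversion invariant). [folklore] -/
theorem map_signFix_pi_haar {n : ℕ} (side : Fin n → Bool) :
    (Measure.pi fun _ : Fin n => (HaarData.haar : Measure G)).map
        (fun (W : Fin n → G) (m : Fin n) => if side m then (W m)⁻¹ else W m) =
      Measure.pi fun _ : Fin n => (HaarData.haar : Measure G) := by
  refine (measurePreserving_pi (fun _ : Fin n => (HaarData.haar : Measure G)) (fun _ => HaarData.haar)
    (f := fun m (h : G) => if side m then h⁻¹ else h) fun m => ?_).map_eq
  show MeasurePreserving (fun h : G => if side m then h⁻¹ else h) HaarData.haar HaarData.haar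
  by_cases hs : side m = true
  · have h' : (fun h : G => if side m then h⁻¹ else h) = fun h => h⁻¹ := by funext h; rw [if_pos hs]
    rw [h']; exact ⟨measurable_inv, HaarData.map_inv⟩
  · have h' : (fun h : G => if side m then h⁻¹ else h) = fun h => h := by funext h; rw [if_neg hs]
    rw [h']; exact MeasurePreserving.id _

/-- **FORESTS ARE PRODUCT HAAR UNDER EVERY GAUGE-INVARIANT LAW**: `ν ∘ (V ↦ V ∘ b)⁻¹ = Haar^n` for every leaf-extension-ordered family `b` (un-sign the previous theorem).
[cite: Balaban1987RG1, (2.1) p.265 (the gauge-invariance sentence this reads); folklore] -/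
theorem map_evalFamily_eq_pi_haar_of_leafOrder {n : ℕ} (b : Fin n → PBond P k) (side : Fin n → Bool)
    (hleaf : ∀ m m' : Fin n, m' < m →
      (if side m then (b m).src else (b m).tgt) ≠ (b m').src ∧ (if side m then (b m).src else (b m).tgt) ≠ (b m').tgt)
    (ν : Measure (GaugeField P k G)) [IsProbabilityMeasure ν] (hν : ∀ v : GaugeTransf P k G, ν.map (GaugeField.gaugeAct v) = ν) :
    ν.map (fun (V : GaugeField P k G) (m : Fin n) => V (b m)) = Measure.pi fun _ : Fin n => (HaarData.haar : Measure G) := by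
  have hF : Measurable fun (W : Fin n → G) (m : Fin n) => if side m then (W m)⁻¹ else W m :=
    measurable_pi_lambda _ fun m =>
      measurable_ite_const (side m = true) (f := fun W : Fin n → G => (W m)⁻¹) (g := fun W => W m)
        (measurable_pi_apply m : Measurable fun W : Fin n → G => W m).inv (measurable_pi_apply m : Measurable fun W : Fin n → G => W m)
  have hcomp : (fun (V : GaugeField P k G) (m : Fin n) => V (b m)) =
      (fun (W : Fin n → G) (m : Fin n) => if side m then (W m)⁻¹ else W m) ∘
        fun (V : GaugeField P k G) (m : Fin n) => if side m then (V (b m))⁻¹ else V (b m) := by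
    funext V; funext m
    by_cases hs : side m = true
    · simp [hs]
    · simp [hs]
  rw [hcomp, ← Measure.map_map hF (measurable_signedEvalFamily b side), map_signedEvalFamily_eq_pi_haar n b side hleaf ν hν,
    map_signFix_pi_haar side]

/-- `∫ φ(V ∘ b) dν = ∫ φ dHaar^n` on every forest, for every gauge-invariant probability law. [cite: Balaban1987RG1, (2.1) p.265 (bookkeeping); folklore] -/
theorem integral_comp_evalFamily_of_leafOrder {n : ℕ} (b : Fin n → PBond P k) (side : Fin n → Bool)
    (hleaf : ∀ m m' : Fin n, m' < m →
      (if side m then (b m).src else (b m).tgt) ≠ (b m').src ∧ (if side m then (b m).src else (b m).tgt) ≠ (b m').tgt)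
    (ν : Measure (GaugeField P k G)) [IsProbabilityMeasure ν] (hν : ∀ v : GaugeTransf P k G, ν.map (GaugeField.gaugeAct v) = ν)
    (φ : (Fin n → G) → ℝ) (hφ : AEStronglyMeasurable φ (Measure.pi fun _ : Fin n => (HaarData.haar : Measure G))) :
    ∫ V, φ (fun m => V (b m)) ∂ν = ∫ W, φ W ∂(Measure.pi fun _ : Fin n => (HaarData.haar : Measure G)) := by
  rw [← map_evalFamily_eq_pi_haar_of_leafOrder b side hleaf ν hν] at hφ ⊢
  exact (integral_map (measurable_evalFamily b).aemeasurable hφ).symm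

omit [MeasurableSpace G] [HaarData G] [MeasurableMul₂ G] [MeasurableInv G] [GaugeGroup G] in
/-- Non-vacuity of the leaf-extension hypothesis: every SINGLE bond (with either side selected) is a forest. [folklore] -/
theorem leafOrder_single (c : PBond P k) (s : Bool) :
    ∀ m m' : Fin 1, m' < m →
      (if (fun _ : Fin 1 => s) m then ((fun _ : Fin 1 => c) m).src else ((fun _ : Fin 1 => c) m).tgt) ≠ ((fun _ : Fin 1 => c) m').src ∧
        (if (fun _ : Fin 1 => s) m then ((fun _ : Fin 1 => c) m).src else ((fun _ : Fin 1 => c) m).tgt) ≠ ((fun _ : Fin 1 => c) m').tgt := by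
  intro m m' h
  exact absurd h (by omega)

omit [MeasurableSpace G] [HaarData G] [MeasurableMul₂ G] [MeasurableInv G] [GaugeGroup G] in
/-- Non-vacuity, two bonds: an ordered PAIR `(c₀, c₁)` is a forest in leaf-extension order as soon as the selected endpoint of `c₁` is not an endpoint of `c₀` (e.g. two
bonds sharing exactly one site, the second one's free end selected; or two disjoint bonds). [folklore] -/
theorem leafOrder_pair (c₀ c₁ : PBond P k) (s₀ s₁ : Bool)
    (h₁ : (if s₁ then c₁.src else c₁.tgt) ≠ c₀.src ∧ (if s₁ then c₁.src else c₁.tgt) ≠ c₀.tgt) :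
    ∀ m m' : Fin 2, m' < m →
      (if ![s₀, s₁] m then (![c₀, c₁] m).src else (![c₀, c₁] m).tgt) ≠ (![c₀, c₁] m').src ∧
        (if ![s₀, s₁] m then (![c₀, c₁] m).src else (![c₀, c₁] m).tgt) ≠ (![c₀, c₁] m').tgt := by
  intro m m' h
  fin_cases m <;> fin_cases m' <;> simp_all

/-! ## §2 At `dU` and at the image law of ANY covariant averaging -/

/-- Forest marginals of `dU` are product Haar (any level). [cite: Balaban1985Averaging, (10) + (12) p.19 (bookkeeping)] -/
theorem map_evalFamily_fieldMeasure_eq_pi_haar_of_leafOrder {n : ℕ} (b : Fin n → PBond P k) (side : Fin n → Bool)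
    (hleaf : ∀ m m' : Fin n, m' < m →
      (if side m then (b m).src else (b m).tgt) ≠ (b m').src ∧ (if side m then (b m).src else (b m).tgt) ≠ (b m').tgt) :
    (fieldMeasure P k G).map (fun (V : GaugeField P k G) (m : Fin n) => V (b m)) = Measure.pi fun _ : Fin n => (HaarData.haar : Measure G) :=
  map_evalFamily_eq_pi_haar_of_leafOrder b side hleaf _ map_gaugeAct_fieldMeasure

end Generic

section ImageLaw

variable {P : Params} {j : ℕ} {G : Type*} [GaugeGroup G] [MeasurableSpace G] [HaarData G] [MeasurableMul₂ G] [MeasurableInv G]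

/-- **`Law_{dU}((Ū(·)(b m))_m) = Haar^n` ON EVERY FOREST OF COARSE BONDS, FOR EVERY COVARIANT AVERAGING** of the standing range with measurable `Ū`.
[cite: Balaban1987RG1, (2.1) p.265] -/
theorem map_evalFamily_imageLaw_eq_pi_haar_of_leafOrder (hj : j + 1 ≤ P.m + P.K) (av : Averaging P j G) (havg : Measurable av.avg)
    {n : ℕ} (b : Fin n → PBond P (j + 1)) (side : Fin n → Bool)
    (hleaf : ∀ m m' : Fin n, m' < m →
      (if side m then (b m).src else (b m).tgt) ≠ (b m').src ∧ (if side m then (b m).src else (b m).tgt) ≠ (b m').tgt) :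
    (fieldMeasure P j G).map (fun (U : GaugeField P j G) (m : Fin n) => av.avg U (b m)) = Measure.pi fun _ : Fin n => (HaarData.haar : Measure G) := by
  haveI := isProbabilityMeasure_imageLaw av havg
  have h := map_evalFamily_eq_pi_haar_of_leafOrder b side hleaf ((fieldMeasure P j G).map av.avg) (map_gaugeAct_imageLaw hj av havg)
  rwa [Measure.map_map (measurable_evalFamily b) havg] at h

/-- … so on every forest the image law of every covariant averaging AGREES WITH `dV`: `∫ φ((Ū U) ∘ b) dU = ∫ φ(V ∘ b) dV`. [cite: Balaban1987RG1, (2.1) p.265 (bookkeeping; E6′ NOT IN PRINT)] -/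
theorem integral_comp_avg_evalFamily_eq_of_leafOrder (hj : j + 1 ≤ P.m + P.K) (av : Averaging P j G) (havg : Measurable av.avg)
    {n : ℕ} (b : Fin n → PBond P (j + 1)) (side : Fin n → Bool)
    (hleaf : ∀ m m' : Fin n, m' < m →
      (if side m then (b m).src else (b m).tgt) ≠ (b m').src ∧ (if side m then (b m).src else (b m).tgt) ≠ (b m').tgt)
    (φ : (Fin n → G) → ℝ) (hφ : AEStronglyMeasurable φ (Measure.pi fun _ : Fin n => (HaarData.haar : Measure G))) :
    ∫ U, φ (fun m => av.avg U (b m)) ∂(fieldMeasure P j G) = ∫ V, φ (fun m => V (b m)) ∂(fieldMeasure P (j + 1) G) := by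
  have hmeas : Measurable fun (U : GaugeField P j G) (m : Fin n) => av.avg U (b m) := (measurable_evalFamily b).comp havg
  have h1 : ∫ U, φ (fun m => av.avg U (b m)) ∂(fieldMeasure P j G) = ∫ W, φ W ∂(Measure.pi fun _ : Fin n => (HaarData.haar : Measure G)) := by
    have hφ' := hφ
    rw [← map_evalFamily_imageLaw_eq_pi_haar_of_leafOrder hj av havg b side hleaf] at hφ' ⊢
    exact (integral_map hmeas.aemeasurable hφ').symm
  have h2 : ∫ V, φ (fun m => V (b m)) ∂(fieldMeasure P (j + 1) G) = ∫ W, φ W ∂(Measure.pi fun _ : Fin n => (HaarData.haar : Measure G)) :=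
    integral_comp_evalFamily_of_leafOrder b side hleaf _ map_gaugeAct_fieldMeasure φ hφ
  rw [h1, h2]

end ImageLaw

/-! ## §3 At the [B10] slot's averaging of record, and the letter for every version of (10) -/

section Slot

open Literature.MathematicalPhysics.QuantumFieldTheory.Balaban1985CMP102.Setting (Scales)
open Literature.MathematicalPhysics.QuantumFieldTheory.Balaban1983to89.B10RunsOfRecord (avOfPrint)
open Literature.MathematicalPhysics.QuantumFieldTheory.Balaban1983to89.B10Eq2HaarCompatibility
open Literature.MathematicalPhysics.QuantumFieldTheory.Balaban1983to89.Node00 (SU TFamily₃)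
open Summit.QuantumFields.YangMills.BalabanUVNodes.N08HaarCompatibilityOneBond (map_gaugeAct_imageLaw_avOfPrint)

variable (N : ℕ) [NeZero N] {L : ℕ}

/-- **`Law_{dU}((Ū(U)(b m))_m) = Haar^n` at `Ū := avOfPrint N S j` ON EVERY FOREST of coarse bonds, EVERY level, every `N`.** [cite: Balaban1987RG1, (2.1) p.265, (0.4) p.253 (bookkeeping)] -/
theorem map_evalFamily_avOfPrint_eq_pi_haar_of_leafOrder (S : Scales L) (j : ℕ) {n : ℕ} (b : Fin n → PBond S.P (j + 1)) (side : Fin n → Bool)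
    (hleaf : ∀ m m' : Fin n, m' < m →
      (if side m then (b m).src else (b m).tgt) ≠ (b m').src ∧ (if side m then (b m).src else (b m).tgt) ≠ (b m').tgt) :
    (fieldMeasure S.P j (SU N)).map (fun (U : GaugeField S.P j (SU N)) (m : Fin n) => (avOfPrint N S j).avg U (b m)) =
      Measure.pi fun _ : Fin n => (HaarData.haar : Measure (SU N)) := by
  haveI := isProbabilityMeasure_imageLaw (avOfPrint N S j) (measurable_avOfPrint N S j)
  have h := map_evalFamily_eq_pi_haar_of_leafOrder b side hleaf ((fieldMeasure S.P j (SU N)).map (avOfPrint N S j).avg)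
    (map_gaugeAct_imageLaw_avOfPrint N S j)
  rwa [Measure.map_map (measurable_evalFamily b) (measurable_avOfPrint N S j)] at h

variable (L) in
/-- **THE E6′ LETTER ON FORESTS, FOR EVERY VERSION**: `∫ (𝔗 S j).T 1 (V) · φ(V ∘ b) dV = ∫ φ(V ∘ b) dV` for every transformation family `𝔗` of the slot, every member,
EVERY level, every forest `b` of coarse bonds and every bounded measurable `φ` — the E6′ identity `(T1)·dV = dV` HOLDS on the σ-algebra of every forest; only the
joint law of CYCLE holonomies is left (E6′ proper, undecided at `N ≥ 2`). [cite: Balaban1985Averaging, (10) p.19; Balaban1987RG1, (2.1) p.265 (bookkeeping; E6′ NOT IN PRINT)] -/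
theorem integral_T_one_mul_comp_evalFamily_eq_of_leafOrder (𝔗 : TFamily₃ N L) (S : Scales L) (j : ℕ) {n : ℕ} (b : Fin n → PBond S.P (j + 1))
    (side : Fin n → Bool)
    (hleaf : ∀ m m' : Fin n, m' < m →
      (if side m then (b m).src else (b m).tgt) ≠ (b m').src ∧ (if side m then (b m).src else (b m).tgt) ≠ (b m').tgt)
    (φ : (Fin n → SU N) → ℝ) (hφm : Measurable φ) (hφb : ∃ C : ℝ, ∀ W, |φ W| ≤ C) :
    ∫ V, (𝔗 S j).T 1 V * φ (fun m => V (b m)) ∂(fieldMeasure S.P (j + 1) (SU N)) =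
      ∫ V, φ (fun m => V (b m)) ∂(fieldMeasure S.P (j + 1) (SU N)) := by
  obtain ⟨C, hC⟩ := hφb
  have h := (𝔗 S j).isRT 1 (integrable_const _) (fun V => φ (fun m => V (b m))) (hφm.comp (measurable_evalFamily b)) ⟨C, fun V => hC _⟩
  rw [h]
  have h1 : (fun U => (1 : Density S.P j (SU N)) U * φ (fun m => (avOfPrint N S j).avg U (b m))) =
      fun U => φ (fun m => (avOfPrint N S j).avg U (b m)) := by
    funext U; simp
  rw [h1]
  have hmeas : Measurable fun (U : GaugeField S.P j (SU N)) (m : Fin n) => (avOfPrint N S j).avg U (b m) :=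
    (measurable_evalFamily b).comp (measurable_avOfPrint N S j)
  have e1 : ∫ U, φ (fun m => (avOfPrint N S j).avg U (b m)) ∂(fieldMeasure S.P j (SU N)) =
      ∫ W, φ W ∂(Measure.pi fun _ : Fin n => (HaarData.haar : Measure (SU N))) := by
    have hφ' : AEStronglyMeasurable φ (Measure.pi fun _ : Fin n => (HaarData.haar : Measure (SU N))) := hφm.aestronglyMeasurable
    rw [← map_evalFamily_avOfPrint_eq_pi_haar_of_leafOrder N S j b side hleaf] at hφ' ⊢
    exact (integral_map hmeas.aemeasurable hφ').symm
  have e2 : ∫ V, φ (fun m => V (b m)) ∂(fieldMeasure S.P (j + 1) (SU N)) =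
      ∫ W, φ W ∂(Measure.pi fun _ : Fin n => (HaarData.haar : Measure (SU N))) :=
    integral_comp_evalFamily_of_leafOrder b side hleaf _ map_gaugeAct_fieldMeasure φ hφm.aestronglyMeasurable
  rw [e1, e2]

variable (L) in
/-- **THE DEFECT `T1 − 1` IS ORTHOGONAL TO EVERY FOREST OBSERVABLE.** [cite: Balaban1985Averaging, (10) p.19; Balaban1987RG1, (2.1) p.265 (bookkeeping; E6′ NOT IN PRINT)] -/
theorem integral_T_one_sub_one_mul_comp_evalFamily_of_leafOrder (𝔗 : TFamily₃ N L) (S : Scales L) (j : ℕ) {n : ℕ}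
    (b : Fin n → PBond S.P (j + 1)) (side : Fin n → Bool)
    (hleaf : ∀ m m' : Fin n, m' < m →
      (if side m then (b m).src else (b m).tgt) ≠ (b m').src ∧ (if side m then (b m).src else (b m).tgt) ≠ (b m').tgt)
    (φ : (Fin n → SU N) → ℝ) (hφm : Measurable φ) (hφb : ∃ C : ℝ, ∀ W, |φ W| ≤ C) :
    ∫ V, ((𝔗 S j).T 1 V - 1) * φ (fun m => V (b m)) ∂(fieldMeasure S.P (j + 1) (SU N)) = 0 := by
  obtain ⟨C, hC⟩ := hφb
  have hφV : AEStronglyMeasurable (fun V : GaugeField S.P (j + 1) (SU N) => φ (fun m => V (b m))) (fieldMeasure S.P (j + 1) (SU N)) :=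
    (hφm.comp (measurable_evalFamily b)).aestronglyMeasurable
  have hbd : ∀ᵐ V ∂(fieldMeasure S.P (j + 1) (SU N)), ‖φ (fun m => V (b m))‖ ≤ C :=
    ae_of_all _ fun V => by rw [Real.norm_eq_abs]; exact hC _
  have h1 : Integrable (fun V => (𝔗 S j).T 1 V * φ (fun m => V (b m))) (fieldMeasure S.P (j + 1) (SU N)) :=
    (integrable_T_one (𝔗 S j)).mul_bdd hφV hbd
  have h2 : Integrable (fun V : GaugeField S.P (j + 1) (SU N) => (1 : ℝ) * φ (fun m => V (b m))) (fieldMeasure S.P (j + 1) (SU N)) :=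
    (integrable_const (1 : ℝ)).mul_bdd hφV hbd
  have hsplit : (fun V => ((𝔗 S j).T 1 V - 1) * φ (fun m => V (b m))) =
      fun V => (𝔗 S j).T 1 V * φ (fun m => V (b m)) - (1 : ℝ) * φ (fun m => V (b m)) := by
    funext V; ring
  rw [hsplit, integral_sub h1 h2, integral_T_one_mul_comp_evalFamily_eq_of_leafOrder N L 𝔗 S j b side hleaf φ hφm ⟨C, hC⟩]
  simp

end Slot

end Summit.QuantumFields.YangMills.BalabanUVNodes.N08HaarCompatibilityForests

end
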